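import Summits.QuantumFields.YangMills.Theorems.BalabanUVNodesN07LocalLettersHBSummand
import Summits.QuantumFields.YangMills.Theorems.BalabanUVNodesN07CubeDomainsAdm22
import Summits.QuantumFields.YangMills.Theorems.BalabanUVNodesK0S5CollarCubeDomains
import Summits.QuantumFields.YangMills.Theorems.BalabanUVNodesN07NearDataOfCentre
import HarnessLib

/-!
# BalabanUVNodes ∕ N07 — S6, THE `HB` SUMMAND AT DOOR (a): **print's three letters of `HB = H_V B` ON THE GRID CUBE `π(□)` OF A PRINT DATUM, FOR THE TORUS FAMILY
# `Node00.cubeDomains` OF THE DATUM's OWN (1.131) TOWER, MODULO THE DATA SIZES (160)∕(155) ONLY** — g2's `letters10On_HB_of_core_adm22_T4` (P12 ∘ FILE 2) with its three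
# geometric hypotheses DISCHARGED BY NAME: (2.1)–(2.2) admissibility (n07-e 39b `adm22_cubeDomains`), «the grid cube lies over `Ω_k`» (39b `inOm_top_cubeDomains_of_mem_box`),
# the core collar `ρ ≤ distBI` to every lower cell (k0-s1-w3 g3 `K0S5CollarCubeDomains.hcollar_cubeDomains`); the level weights chosen canonically

Cell `pub-ymgap`, width seat `pub-ymgap-dag-n07-w4` gen 2 (director-ym №197 ∕ HUMAN RULING D-0149), node N07 = [15] = [Balaban1985Variational] (CMP **102** (1985) 277–309);
[6] = [Balaban1985RegularSpaces]; sub-target S6 of plan g81's `W-SEAT-START-LIST.md` v8 § n07 item 4, door (a) of n07-e g18's LOCATED-TOWER (INBOX l.27663; answered (a) at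
l.27845).  `--kind proof --supports stmt-QuantumFields-20542 --as helper`; count-neutral; def-free; three theorems (v1.1 = v1 + the uniform-size corollary; v1.2 + the print-shape corollary through `N07NearDataOfCentre`), compositions BY NAME; nothing restated.

WHY.  Print p. 302: *«for a plaquette p, or a bond b, we take a unit cube Δ₀ ⊂ B_j(Λ_j) containing p or b.  The cube Δ₀ is contained in a big cube of the size 2R₁M₁Lʲη and we
take □ as this big cube»*; [6] p. 98–99 (1.131): the tower `□_j^{(j)}` of the cube `□` with collars `ρ·gs(k−j)` (`□_k^{(k)} = [a − ρ, a + M − 1 + ρ]`); p. 304 (164).  At door (a)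
the S6 HEAD keys the per-cube heart on `D := Node00.cubeDomains (F.P K) a M ρ (K − n)` (the cover images of the datum's own tower, n07-e module 39) and the window
`Y := π '' □ = cover '' box L a M (K − n)`.  THIS FILE records that, for this `D` and `Y`, EVERY geometric hypothesis of the `HB`-summand socket is in the tree: the bonds of `Y`
are top-level (`□ ⊆ □_k`, 39b), every lower territory `Λ_j`, `j < k`, is at least `ρ` top units away from `□` (k0-s1-w3's collar: `□_{j+1}^{(j)}` has margin `≥ ρ·L^{k−j}` around
`□^{(j)}`), and the family is (2.1)–(2.2)-admissible at big blocks `L·M_h` dividing `ρ`, `a`, `M` and the level-`(K−n)` torus (39b).  What remains displayed is exactly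
print's input to (161): the NEAR size (160) of the datum on the top cells and the FAR size (155) below — the data lane (BRIDGE-92 of n07-e g18's map) — plus the kernel
formula of `H_V`, the (163)-type smallness `8C_dCB₃e^{−δ₁ρ} ≤ θ` («R₁M₁ sufficiently big»: P12's `exists_collar_threshold`) and non-wrapping of `□₀`.

WHAT IS PROVED.  ★★★ `letters10On_HB_cubeDomains_box (F : T4Family) (N)`: for P12's constants `M_h⁰, R₀, C, δ₀, δ₁, B₃`: for all heights `1 ≤ K − n`, `K − n + 1 ≤ F.m + K`
(`K − n ≤ m + K` of `F.P K` displayed), sizes `M_h = L^{a′} ≥ M_h⁰`, `R ≥ R₀`, `a′ + 3 ≤ F.m + n`, every corner `a`, side `M`, collar `ρ` with `L·M_h ∣ ρ`, `L·M_h ∣ a_i`, `L·M_h ∣ M`,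
`L·M_h ∣ sitesPerDir (K − n)`, `R·(L·M_h) ≤ ρ`, non-wrapping `Set.InjOn π (cube L a M ρ (K−n) 0)`, constants `C_d, M_Δ, ε₁ ≥ 0`, downward-2-comparable radii `ε` with
`ε(K−n) ≥ 0`, `8C_dCB₃e^{−δ₁ρ} ≤ θ`, every componentwise extension `H_V` of `flatH (F.P K) (K−n) D` and every datum `B : 𝔅_D → M_N(ℂ)` with near size
`‖B c‖ ≤ C_d·M_Δ·ε₁·(distBI(b, c) + 1)` on the top cells (from the bonds of `π '' □`) and far size `‖B c‖ ≤ C_d·M_Δ·ε(j(c))·L^{(K−n)−j(c)}` below: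
`Letters10On (π '' □) η_{K−n} t (H_V B)` for every `t > ¼M_Δ·max{4C_dCB₃ε₁, θ·ε(K−n)}`.  ★★ `letters10On_H_uniform_cubeDomains_box` (v1.1): the same for a datum of
UNIFORM size `‖B c‖ ≤ s` (the door for `HD(A₁ + HB) = H_V𝔇(A′)` and any one-size `H`-datum): `t > ¼·max{4CB₃s, θs}`.  ★★★ `letters10On_HB_cubeDomains_box_of_centred`
(v1.2): the data in PRINT's shapes — (160) centred at a point of `□` on the top cells, (155) uniform below — with `M_Δ := M` («M_Δ = M for Δ = □»).
HONEST SCOPE: composition of landed theorems; the data sizes, the kernel formula, the numerics and non-wrapping are HYPOTHESES; ONE of the three summands of (159); nothing of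
[15]∕[6]∕[B6-II] asserted beyond lit-balaban's kernel-checked chain behind P12; the tokens `LocalLetters165∕167TopStep(Core)` NOT discharged; stub 1 ∕ K0⁷ ∕ K1⁷ NOT closed; N07
NOT discharged; counts unmoved (typed 28∕28 · discharged 5∕27); one finite 𝕋⁴ programme at fixed ε — R4 closes the conditional finite-𝕋⁴ rung `BalabanLadder.UV` ONLY; the YM
mass gap (Clay) is NOT proved by any of this; nothing continuum ∕ ℝ⁴ ∕ OS.  No `def`, no `instance`, no `notation`, no `sorry`.
-/

set_option autoImplicit false

noncomputable section

open scoped BigOperators Matrix.Norms.L2Operator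

namespace Summit.QuantumFields.YangMills.BalabanUVNodes.N07LocalLettersHBAtCubeDomains

open Literature.MathematicalPhysics.QuantumFieldTheory.Balaban1983to89
open Literature.MathematicalPhysics.QuantumFieldTheory.Balaban1983to89.Node00
open B15Eq112TorusCover (cover)
open B14DomainGeom (Pt)
open B8Eq131Cubes (box cube)
open B11Eq115Space (levOf)
open B6SectADomainsV1 (Domains)
open B6SectAOperatorsV1 (BondIdx)
open T4Continuum (T4Family)
open Summit.QuantumFields.YangMills.Theorems.FlatCubeOpsText (Adm22 distBI)
open Summit.QuantumFields.YangMills.Theorems.K0FlatCubeOpsTextP (IsLevWeight flatH)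
open Summit.QuantumFields.YangMills.Theorems.K0S5CollarCubeDomains (hcollar_cubeDomains)
open Summit.QuantumFields.YangMills.BalabanUVNodes.N07CubeDomainsAdm22 (adm22_cubeDomains inOm_top_cubeDomains_of_mem_box)
open Summit.QuantumFields.YangMills.BalabanUVNodes.N07HalvingStepTopOfLocalLetters (Letters10On)
open Summit.QuantumFields.YangMills.BalabanUVNodes.N07LocalLettersHBSummand (letters10On_HB_of_core_adm22_T4)
open Summit.QuantumFields.YangMills.BalabanUVNodes.N07NearDataOfCentre (near_of_centred_box)
open B5Eq117TorusCarriers (Mk)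
open B5Eq118OneStroke (iterBlockOf)
open B5Prop12FieldsLattice (distSite)

open scoped Classical in
/-- ★★★ **[15] (164) ⇒ THE `HB`-LETTERS OF (165) ON THE GRID CUBE OF A PRINT DATUM, AT THE TORUS FAMILY OF ITS OWN TOWER, MODULO THE DATA** (statement in the header): the
geometric hypotheses of `letters10On_HB_of_core_adm22_T4` at `D := cubeDomains (F.P K) a M ρ (K − n) hk`, `Y := cover '' box L a M (K − n)` discharged by 39b
(`adm22_cubeDomains`, `inOm_top_cubeDomains_of_mem_box`) and k0-s1-w3's `hcollar_cubeDomains` (`R′ := ρ`), with the canonical level weights `w m b = (L^{j(b₋)}·L^{−(K−n)})^m`.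
[cite: Balaban1985Variational, p.302 («we take □ as this big cube»), (160)–(161) p.303, (163)–(165) p.304; Balaban1985RegularSpaces, (1.131) pp.98–99; Balaban1984PropagatorsII, (2.1)–(2.2) p.224, (2.60) p.234] -/
theorem letters10On_HB_cubeDomains_box (F : T4Family) (N : ℕ) [NeZero N] :
    ∃ (Mh₀ R₀ : ℕ) (C δ₀ δ₁ B₃ : ℝ), 0 ≤ C ∧ 0 < δ₀ ∧ 0 < δ₁ ∧ 0 < B₃ ∧
    ∀ (n K : ℕ) (_ : 1 ≤ K - n) (_ : K - n + 1 ≤ F.m + K) (hk : K - n ≤ (F.P K).m + (F.P K).K)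
      {Mh R a' : ℕ} (_ : Mh = F.L ^ a') (_ : Mh₀ ≤ Mh) (_ : R₀ ≤ R) (_ : a' + 3 ≤ F.m + n)
      {a : Pt (F.P K).d} {M ρ : ℕ}
      (_ : F.L * Mh ∣ ρ) (_ : ∀ i, ((F.L * Mh : ℕ) : ℤ) ∣ a i) (_ : F.L * Mh ∣ M) (_ : F.L * Mh ∣ (F.P K).sitesPerDir (K - n)) (_ : R * (F.L * Mh) ≤ ρ)
      (_ : Set.InjOn (cover (F.P K)) (cube (F.P K).L a M ρ (K - n) 0))
      {Cd MΔ ε₁ θ : ℝ} {ε : ℕ → ℝ}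
      (_ : 0 ≤ Cd) (_ : 0 ≤ MΔ) (_ : 0 ≤ ε₁) (_ : 0 ≤ ε (K - n)) (_ : ∀ j, j < K - n → ε j ≤ 2 * ε (j + 1))
      (_ : 8 * Cd * C * B₃ * Real.exp (-(δ₁ * (ρ : ℝ))) ≤ θ)
      {HV : (BondIdx (cubeDomains (F.P K) a M ρ (K - n) hk) → MatA N) →ₗ[ℂ] (PBond (F.P K) 0 → MatA N)}
      (_ : ∀ (A : BondIdx (cubeDomains (F.P K) a M ρ (K - n) hk) → MatA N) (b : PBond (F.P K) 0),
        HV A b = ∑ c, ((flatH (F.P K) (K - n) (cubeDomains (F.P K) a M ρ (K - n) hk) (Pi.single c 1) b : ℝ) : ℂ) • A c)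
      {B : BondIdx (cubeDomains (F.P K) a M ρ (K - n) hk) → MatA N}
      (_ : ∀ b : PBond (F.P K) 0, b.src ∈ cover (F.P K) '' box (F.P K).L a M (K - n) →
        ∀ c : BondIdx (cubeDomains (F.P K) a M ρ (K - n) hk), (c.1.1 : ℕ) = K - n →
          ‖B c‖ ≤ Cd * MΔ * ε₁ * (distBI (cubeDomains (F.P K) a M ρ (K - n) hk) b c + 1))
      (_ : ∀ c : BondIdx (cubeDomains (F.P K) a M ρ (K - n) hk), (c.1.1 : ℕ) < K - n →
        ‖B c‖ ≤ Cd * MΔ * ε (c.1.1 : ℕ) * ((F.P K).L : ℝ) ^ ((K - n) - (c.1.1 : ℕ)))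
      {t : ℝ} (_ : 1 / 4 * MΔ * max (4 * Cd * C * B₃ * ε₁) (θ * ε (K - n)) < t),
      Letters10On (cover (F.P K) '' box (F.P K).L a M (K - n)) ((F.P K).eta (K - n)) t (HV B) := by
  obtain ⟨Mh₀, R₀, C, δ₀, δ₁, B₃, hC, hδ₀, hδ₁, hB₃, hmain⟩ := letters10On_HB_of_core_adm22_T4 F N
  refine ⟨Mh₀, R₀, C, δ₀, δ₁, B₃, hC, hδ₀, hδ₁, hB₃, ?_⟩
  intro n K hk1 hk' hk Mh R a' hMha hMh hR hsize a M ρ hρ ha hM hper hRρ hinj Cd MΔ ε₁ θ ε hCd hMΔ hε₁ hεk hcomp h163 HV hHv B hBnear hBfar t ht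
  -- `1 ≤ L·M_h`
  have hM₁ : 1 ≤ F.L * Mh := by
    rw [hMha]
    exact Nat.one_le_iff_ne_zero.mpr (Nat.mul_ne_zero (by have := F.hL11; omega) (pow_ne_zero _ (by have := F.hL11; omega)))
  have hLP : (F.P K).L = F.L := rfl
  -- the family, its admissibility (39b), the canonical level weights
  have hAdm : Adm22 (cubeDomains (F.P K) a M ρ (K - n) hk) R (F.L * Mh) :=
    adm22_cubeDomains (P := F.P K) hM₁ hρ (by simpa [hLP] using ha) hM hper hRρ
  have hw : IsLevWeight (F.P K) (K - n) (cubeDomains (F.P K) a M ρ (K - n) hk)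
      (fun m b => (((F.P K).L : ℝ) ^ levOf (fun j => {x : Site (F.P K) 0 | (cubeDomains (F.P K) a M ρ (K - n) hk).InOm j x}) (K - n) b.src *
        (((F.P K).L : ℝ)⁻¹) ^ (K - n)) ^ m) := fun _ _ => rfl
  -- the window lies over `Ω_k` (39b) and sees the lower cells at `distBI ≥ ρ` (k0-s1-w3)
  have hY : ∀ x ∈ cover (F.P K) '' box (F.P K).L a M (K - n), (cubeDomains (F.P K) a M ρ (K - n) hk).InOm (K - n) x := by
    rintro _ ⟨x, hx, rfl⟩
    exact inOm_top_cubeDomains_of_mem_box hinj hk1 hx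
  have hcol : ∀ b : PBond (F.P K) 0, b.src ∈ cover (F.P K) '' box (F.P K).L a M (K - n) →
      ∀ c : BondIdx (cubeDomains (F.P K) a M ρ (K - n) hk), (c.1.1 : ℕ) < K - n →
        (ρ : ℝ) ≤ distBI (cubeDomains (F.P K) a M ρ (K - n) hk) b c := by
    intro b hb c hc
    have h := hcollar_cubeDomains (hk := hk) b hb c (by simpa using hc)
    simpa using h
  exact hmain n K hk1 hk' hMha hMh hR hsize (cubeDomains (F.P K) a M ρ (K - n) hk) rfl hAdm _ hw hCd hMΔ hε₁ hεk hcomp h163 hY hcol hHv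
    hBnear hBfar ht

open scoped Classical in
/-- ★★ **THE SAME FOR A DATUM OF UNIFORM SIZE** (the door for the third summand `HD(A₁ + HB) = H_V 𝔇(A′)` of (159), whose datum is `O(ρ₀²)`-small at EVERY cell — P3a ∕ (157)
— and for any `H`-applied datum with one size): if `‖B c‖ ≤ s` for all cells `c` (`0 ≤ s`) and `8CB₃e^{−δ₁ρ} ≤ θ`, then `Letters10On (π '' □) η_{K−n} t (H_V B)` for every
`t > ¼·max{4CB₃, θ}·s` … precisely for `t > ¼·max{4CB₃s, θs}` — `letters10On_HB_cubeDomains_box` at `C_d := 1`, `M_Δ := 1`, `ε₁ := s`, `ε ≡ s` (a uniform bound dominates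
both the near shape `s·(distBI + 1)` and the far shape `s·L^{k−j}`, since `distBI ≥ 0` and `L ≥ 1`).
[cite: Balaban1985Variational, (157) p.302, (159) p.303, (164)–(165) p.304; Balaban1984PropagatorsII, Cor. 2.8 (2.150)–(2.151) p.249] -/
theorem letters10On_H_uniform_cubeDomains_box (F : T4Family) (N : ℕ) [NeZero N] :
    ∃ (Mh₀ R₀ : ℕ) (C δ₀ δ₁ B₃ : ℝ), 0 ≤ C ∧ 0 < δ₀ ∧ 0 < δ₁ ∧ 0 < B₃ ∧
    ∀ (n K : ℕ) (_ : 1 ≤ K - n) (_ : K - n + 1 ≤ F.m + K) (hk : K - n ≤ (F.P K).m + (F.P K).K)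
      {Mh R a' : ℕ} (_ : Mh = F.L ^ a') (_ : Mh₀ ≤ Mh) (_ : R₀ ≤ R) (_ : a' + 3 ≤ F.m + n)
      {a : Pt (F.P K).d} {M ρ : ℕ}
      (_ : F.L * Mh ∣ ρ) (_ : ∀ i, ((F.L * Mh : ℕ) : ℤ) ∣ a i) (_ : F.L * Mh ∣ M) (_ : F.L * Mh ∣ (F.P K).sitesPerDir (K - n)) (_ : R * (F.L * Mh) ≤ ρ)
      (_ : Set.InjOn (cover (F.P K)) (cube (F.P K).L a M ρ (K - n) 0))
      {s θ : ℝ} (_ : 0 ≤ s) (_ : 8 * C * B₃ * Real.exp (-(δ₁ * (ρ : ℝ))) ≤ θ)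
      {HV : (BondIdx (cubeDomains (F.P K) a M ρ (K - n) hk) → MatA N) →ₗ[ℂ] (PBond (F.P K) 0 → MatA N)}
      (_ : ∀ (A : BondIdx (cubeDomains (F.P K) a M ρ (K - n) hk) → MatA N) (b : PBond (F.P K) 0),
        HV A b = ∑ c, ((flatH (F.P K) (K - n) (cubeDomains (F.P K) a M ρ (K - n) hk) (Pi.single c 1) b : ℝ) : ℂ) • A c)
      {B : BondIdx (cubeDomains (F.P K) a M ρ (K - n) hk) → MatA N} (_ : ∀ c, ‖B c‖ ≤ s)
      {t : ℝ} (_ : 1 / 4 * max (4 * C * B₃ * s) (θ * s) < t),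
      Letters10On (cover (F.P K) '' box (F.P K).L a M (K - n)) ((F.P K).eta (K - n)) t (HV B) := by
  obtain ⟨Mh₀, R₀, C, δ₀, δ₁, B₃, hC, hδ₀, hδ₁, hB₃, hmain⟩ := letters10On_HB_cubeDomains_box F N
  refine ⟨Mh₀, R₀, C, δ₀, δ₁, B₃, hC, hδ₀, hδ₁, hB₃, ?_⟩
  intro n K hk1 hk' hk Mh R a' hMha hMh hR hsize a M ρ hρ ha hM hper hRρ hinj s θ hs h163 HV hHv B hB t ht
  have hL1 : (1 : ℝ) ≤ ((F.P K).L : ℝ) := by exact_mod_cast (F.P K).L_pos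
  refine hmain n K hk1 hk' hk hMha hMh hR hsize hρ ha hM hper hRρ hinj (Cd := 1) (MΔ := 1) (ε₁ := s) (θ := θ) (ε := fun _ => s)
    zero_le_one zero_le_one hs hs (fun _ _ => by linarith) (by simpa using h163) hHv (fun b _ c _ => ?_) (fun c _ => ?_) (by simpa using ht)
  · -- near shape: `s ≤ s·(distBI + 1)`
    have hd := Summit.QuantumFields.YangMills.Theorems.HalvingQuarterCubeSeq.distBI_nonneg (cubeDomains (F.P K) a M ρ (K - n) hk) b c
    calc ‖B c‖ ≤ s := hB c
      _ ≤ 1 * 1 * s * (distBI (cubeDomains (F.P K) a M ρ (K - n) hk) b c + 1) := by nlinarith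
  · -- far shape: `s ≤ s·L^{k−j}`
    have hpow : (1 : ℝ) ≤ ((F.P K).L : ℝ) ^ ((K - n) - (c.1.1 : ℕ)) := one_le_pow₀ hL1
    calc ‖B c‖ ≤ s := hB c
      _ ≤ 1 * 1 * s * ((F.P K).L : ℝ) ^ ((K - n) - (c.1.1 : ℕ)) := by nlinarith

open scoped Classical in
/-- ★★★ **THE SAME WITH THE DATA IN PRINT's OWN SHAPES** — (160) CENTRED at a point `x_c` of the window («|B(x,x′)| < (8d²L² + 4L²|x − y|)ε₁»: `‖B c‖ ≤ β₁·(dist_k(c₋, Bᵏ(π x_c)) + 1)` on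
the top cells) and (155) UNIFORM below («|B| < 18d²L³Mε₀»: `‖B c‖ ≤ β₂` on every lower cell): then `Letters10On (π '' □) η_{K−n} t (H_V B)` for every
`t > ¼·M·max{4CB₃β₁, θ·(β₂∕M)}` provided `8CB₃e^{−δ₁ρ} ≤ θ` — `letters10On_HB_cubeDomains_box` at `C_d := 1`, `M_Δ := M` (print's «M_Δ = M for Δ = □»), `ε₁ := β₁`, `ε ≡ β₂∕M`,
the near hypothesis supplied by this seat's `N07NearDataOfCentre.near_of_centred_box`, the far one by `L^{k−j} ≥ 1`.  The (160)∕(155) bounds themselves (BRIDGE-92) are the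
HYPOTHESES `hX₁`, `hX₂`. [cite: Balaban1985Variational, (155) p.302, (160)–(161) p.303, (163)–(165) p.304] -/
theorem letters10On_HB_cubeDomains_box_of_centred (F : T4Family) (N : ℕ) [NeZero N] :
    ∃ (Mh₀ R₀ : ℕ) (C δ₀ δ₁ B₃ : ℝ), 0 ≤ C ∧ 0 < δ₀ ∧ 0 < δ₁ ∧ 0 < B₃ ∧
    ∀ (n K : ℕ) (_ : 1 ≤ K - n) (_ : K - n + 1 ≤ F.m + K) (hk : K - n ≤ (F.P K).m + (F.P K).K)
      {Mh R a' : ℕ} (_ : Mh = F.L ^ a') (_ : Mh₀ ≤ Mh) (_ : R₀ ≤ R) (_ : a' + 3 ≤ F.m + n)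
      {a : Pt (F.P K).d} {M ρ : ℕ} (_ : 1 ≤ M)
      (_ : F.L * Mh ∣ ρ) (_ : ∀ i, ((F.L * Mh : ℕ) : ℤ) ∣ a i) (_ : F.L * Mh ∣ M) (_ : F.L * Mh ∣ (F.P K).sitesPerDir (K - n)) (_ : R * (F.L * Mh) ≤ ρ)
      (_ : Set.InjOn (cover (F.P K)) (cube (F.P K).L a M ρ (K - n) 0))
      {xc : Pt (F.P K).d} (_ : xc ∈ box (F.P K).L a M (K - n))
      {β₁ β₂ θ : ℝ} (_ : 0 ≤ β₁) (_ : 0 ≤ β₂) (_ : 8 * C * B₃ * Real.exp (-(δ₁ * (ρ : ℝ))) ≤ θ)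
      {HV : (BondIdx (cubeDomains (F.P K) a M ρ (K - n) hk) → MatA N) →ₗ[ℂ] (PBond (F.P K) 0 → MatA N)}
      (_ : ∀ (A : BondIdx (cubeDomains (F.P K) a M ρ (K - n) hk) → MatA N) (b : PBond (F.P K) 0),
        HV A b = ∑ c, ((flatH (F.P K) (K - n) (cubeDomains (F.P K) a M ρ (K - n) hk) (Pi.single c 1) b : ℝ) : ℂ) • A c)
      {B : BondIdx (cubeDomains (F.P K) a M ρ (K - n) hk) → MatA N}
      (_ : ∀ c : BondIdx (cubeDomains (F.P K) a M ρ (K - n) hk), (c.1.1 : ℕ) = K - n →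
        ‖B c‖ ≤ β₁ * (distSite (Mk (F.P K) (c.1.1 : ℕ)) c.1.2.src (iterBlockOf (c.1.1 : ℕ) (cover (F.P K) xc)) + 1))
      (_ : ∀ c : BondIdx (cubeDomains (F.P K) a M ρ (K - n) hk), (c.1.1 : ℕ) < K - n → ‖B c‖ ≤ β₂)
      {t : ℝ} (_ : 1 / 4 * (M : ℝ) * max (4 * C * B₃ * β₁) (θ * (β₂ / M)) < t),
      Letters10On (cover (F.P K) '' box (F.P K).L a M (K - n)) ((F.P K).eta (K - n)) t (HV B) := by
  obtain ⟨Mh₀, R₀, C, δ₀, δ₁, B₃, hC, hδ₀, hδ₁, hB₃, hmain⟩ := letters10On_HB_cubeDomains_box F N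
  refine ⟨Mh₀, R₀, C, δ₀, δ₁, B₃, hC, hδ₀, hδ₁, hB₃, ?_⟩
  intro n K hk1 hk' hk Mh R a' hMha hMh hR hsize a M ρ hM hρ ha hMd hper hRρ hinj xc hxc β₁ β₂ θ hβ₁ hβ₂ h163 HV hHv B hX₁ hX₂ t ht
  have hMr : (1 : ℝ) ≤ M := by exact_mod_cast hM
  have hM0 : (0 : ℝ) < M := by linarith
  have hL1 : (1 : ℝ) ≤ ((F.P K).L : ℝ) := by exact_mod_cast (F.P K).L_pos
  -- the near hypothesis from the centred bound (`M_Δ := M`), the far one from `L^{k−j} ≥ 1`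
  have hnear := near_of_centred_box (cubeDomains (F.P K) a M ρ (K - n) hk) (a := a) (M := M) hk hM hxc hβ₁ hX₁
  refine hmain n K hk1 hk' hk hMha hMh hR hsize hρ ha hMd hper hRρ hinj (Cd := 1) (MΔ := (M : ℝ)) (ε₁ := β₁) (θ := θ)
    (ε := fun _ => β₂ / M) zero_le_one hM0.le hβ₁ (div_nonneg hβ₂ hM0.le) (fun _ _ => by linarith [div_nonneg hβ₂ hM0.le])
    (by simpa using h163) hHv (fun b hb c hc => ?_) (fun c hc => ?_) (by simpa using ht)
  · have h := hnear b hb c hc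
    calc ‖B c‖ ≤ β₁ * M * (distBI (cubeDomains (F.P K) a M ρ (K - n) hk) b c + 1) := h
      _ = 1 * (M : ℝ) * β₁ * (distBI (cubeDomains (F.P K) a M ρ (K - n) hk) b c + 1) := by ring
  · have hpow : (1 : ℝ) ≤ ((F.P K).L : ℝ) ^ ((K - n) - (c.1.1 : ℕ)) := one_le_pow₀ hL1
    have hMβ : 1 * (M : ℝ) * (β₂ / M) = β₂ := by field_simp
    calc ‖B c‖ ≤ β₂ := hX₂ c hc
      _ ≤ β₂ * ((F.P K).L : ℝ) ^ ((K - n) - (c.1.1 : ℕ)) := by nlinarith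
      _ = 1 * (M : ℝ) * (β₂ / M) * ((F.P K).L : ℝ) ^ ((K - n) - (c.1.1 : ℕ)) := by rw [hMβ]

end Summit.QuantumFields.YangMills.BalabanUVNodes.N07LocalLettersHBAtCubeDomains

end
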